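import Summits.CriticalPhenomena.PercolationContinuityZ3.Theorems.PercNearOneGluingAdditiveGluingSetObserverUnfoldDefs
import Summits.CriticalPhenomena.PercolationContinuityZ3.Theorems.PercNearOneGluingNoHeavyLowerTailCovTauA2H
import Summits.CriticalPhenomena.PercolationContinuityZ3.Theorems.PercNearOneGluingAdditiveGluingSetObserverHtwBase
import HarnessLib

/-!
# Conjecture G / SET-W via a SET observer, XVI: the killed-set-observer functional of META-A2 — properties, star decomposition, base case

Support file (`--supports stmt-CriticalPhenomena-4576`); no definitions, no named facts, no sorries.  Seat (b) V⁺-form `png-dp-vplus`, gen 13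
(memo MEMO-gen12.md §4(d), §10 (H), §12).  Set-observer version of prim-hp-4's `…NoHeavyLowerTailCovTauMetaA2Defs.lean` in the finite-sum
framework of `BHK2006.core`, for the functionals `CovTau.EavSet` (`E^O_A(N) = μ_{G[U]}({O ~ v} ∩ {O ≁ A ∪ N})`) and `CovTau.qavSet`
(`q^O_A(U') = 1{O ⊆ U'}·E^O_A(∅)/M_A(∅)`) of `…SetObserverUnfoldDefs.lean`.
* `EavSet_nonneg/le_Mav/antitone/eq_zero_of_mem/eq_zero_of_obs_mem`, `qavSet_nonneg`;
* `mem_obsSetEv_iff_restrict`, **`EavSet_step`** — BHK's identity (6) for the killed set observer (conditioning on the open edges at `Z ⊆ N`,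
  `O ∩ Z = ∅`: every observer avoids `Z`, so its connections in `G[U]` are its connections in `G[U ∖ Z]` off the neighbour set `S(ω)`);
* `sum_weight_inter_edgesIn`, `sum_weight_ind_inter_edgesIn`, **`setObs_twoSource_restrict`** — the base case
  `M_A(N')·E^O_A(N) ≤ E^O_A(∅)·M_A(N ∪ N')` in `G[U]`, transported from gen 12's `SetSurplus.setObs_twoSource_base` (weights zeroed outside
  `edgesIn U`, `BHK2006.integral_comp_sdiff_prodBernoulli'`).
[cite: VandenbergHaggstromKahn2005, Thm. 1.3 (p. 6), §1 p. 4 identity (6), §2.1 Lemmas 2.3–2.4 (p. 10)] [cite: KozmaNitzan2024, Conj. 4 (p. 32)]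
-/

noncomputable section

namespace Summit.CriticalPhenomena.PercolationContinuityZ3.Theorems.CovTau

open MeasureTheory
open Literature.Probability.LatticeModels (prodBernoulli)
open Literature.Probability.Percolation
open Literature.Probability.Percolation.BHK2006
open Literature.Probability.Percolation.DecisionTree (ind ind_of_mem ind_of_not_mem ind_nonneg)
open scoped Classical

variable {V : Type*} [Fintype V]

/-! ### Elementary properties of the set-observer functional -/

section Props

variable {w : Sym2 V → ℝ} (hw0 : ∀ e, 0 ≤ w e) (hw1 : ∀ e, w e ≤ 1)
include hw0 hw1

/-- `E^O_A(N) ≥ 0`. [folklore] -/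
theorem EavSet_nonneg (U : Finset V) (A : Set V) (O : Finset V) (v : V) (N : Set V) : 0 ≤ EavSet w U A O v N :=
  Finset.sum_nonneg fun ω _ => mul_nonneg (weight_nonneg hw0 hw1 ω) (ind_nonneg _ _)

/-- `E^O_A(N) ≤ M_A(N)`: `{O ~ v} ∩ {O ≁ A ∪ N} ⊆ {v ↮ A ∪ N}`. [folklore] -/
theorem EavSet_le_Mav (U : Finset V) (A : Set V) (O : Finset V) (v : V) (N : Set V) :
    EavSet w U A O v N ≤ Mav w U A v N := by
  refine Finset.sum_le_sum fun ω _ => mul_le_mul_of_nonneg_left ?_ (weight_nonneg hw0 hw1 ω)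
  by_cases h : ω ∈ ({ω : Set (Sym2 V) | ∃ o ∈ O, (openGraph (ω ∩ edgesIn U)).Reachable o v} ∩
      {ω | ∀ o ∈ O, ∀ a ∈ A ∪ N, ¬ (openGraph (ω ∩ edgesIn U)).Reachable o a})
  · rw [ind_of_mem h, ind_of_mem]
    obtain ⟨⟨o, ho, hov⟩, h2⟩ := h
    intro a ha hva
    exact h2 o ho a ha (hov.trans hva)
  · rw [ind_of_not_mem h]; exact ind_nonneg _ _

/-- `E^O_A` is antitone in the source set. [cite: VandenbergHaggstromKahn2005, §1 p. 3] -/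
theorem EavSet_antitone (U : Finset V) (A : Set V) (O : Finset V) (v : V) {N N' : Set V} (h : N ⊆ N') :
    EavSet w U A O v N' ≤ EavSet w U A O v N := by
  refine Finset.sum_le_sum fun ω _ => mul_le_mul_of_nonneg_left ?_ (weight_nonneg hw0 hw1 ω)
  by_cases h' : ω ∈ ({ω : Set (Sym2 V) | ∃ o ∈ O, (openGraph (ω ∩ edgesIn U)).Reachable o v} ∩
      {ω | ∀ o ∈ O, ∀ a ∈ A ∪ N', ¬ (openGraph (ω ∩ edgesIn U)).Reachable o a})
  · rw [ind_of_mem h', ind_of_mem]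
    exact ⟨h'.1, fun o ho a ha => h'.2 o ho a (Set.union_subset_union_right A h ha)⟩
  · rw [ind_of_not_mem h']; exact ind_nonneg _ _

end Props

/-- `E^O_A(N) = 0` when `v ∈ A ∪ N` (`o ↔ v` forces `o ↔` a member of the avoided set). [folklore] -/
theorem EavSet_eq_zero_of_mem (w : Sym2 V → ℝ) (U : Finset V) (A : Set V) (O : Finset V) (v : V) {N : Set V}
    (hv : v ∈ A ∪ N) : EavSet w U A O v N = 0 :=
  Finset.sum_eq_zero fun ω _ => by
    rw [ind_of_not_mem]
    · ring
    · rintro ⟨⟨o, ho, hov⟩, h2⟩; exact h2 o ho v hv hov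

/-- `E^O_A(N) = 0` when an observer lies in the avoided set (`o ↔ o`). [folklore] -/
theorem EavSet_eq_zero_of_obs_mem (w : Sym2 V → ℝ) (U : Finset V) (A : Set V) (O : Finset V) (v : V) {N : Set V}
    {o : V} (ho : o ∈ O) (hoN : o ∈ A ∪ N) : EavSet w U A O v N = 0 :=
  Finset.sum_eq_zero fun ω _ => by
    rw [ind_of_not_mem]
    · ring
    · rintro ⟨-, h2⟩; exact h2 o ho o hoN (SimpleGraph.Reachable.refl o)

/-- `q^O_A(U) ≥ 0`. [folklore] -/
theorem qavSet_nonneg {w : Sym2 V → ℝ} (hw0 : ∀ e, 0 ≤ w e) (hw1 : ∀ e, w e ≤ 1) (U : Finset V) (A : Set V) (O : Finset V) (v : V) :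
    0 ≤ qavSet w U A O v := by
  unfold qavSet
  refine mul_nonneg (by split_ifs <;> norm_num) (div_nonneg (EavSet_nonneg hw0 hw1 U A O v ∅) (Mav_nonneg hw0 hw1 U A v ∅))

/-! ### Star decomposition of the set-observer functional (BHK's identity (6)) -/

omit [Fintype V] in
/-- **BHK's identity (6) for the killed set observer, pointwise**: for `Z ⊆ N`, `Z ⊆ U`, `O ∩ Z = ∅`,
`{O ~ v} ∩ {O ≁ A ∪ N}` in `G[U]` is the event `{O ~ v} ∩ {O ≁ A ∪ ((N ∖ Z) ∪ S(ω))}` in `G[U ∖ Z]`.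
[cite: VandenbergHaggstromKahn2005, §1 p. 4, identity (6)] -/
theorem mem_obsSetEv_iff_restrict {U Z : Finset V} (hZU : Z ⊆ U) {A N : Set V} (hZN : (↑Z : Set V) ⊆ N) {O : Finset V}
    (hOZ : ∀ o ∈ O, o ∉ Z) (v : V) (ω : Set (Sym2 V)) :
    ω ∈ ({ω : Set (Sym2 V) | ∃ o ∈ O, (openGraph (ω ∩ edgesIn U)).Reachable o v} ∩
      {ω | ∀ o ∈ O, ∀ a ∈ A ∪ N, ¬ (openGraph (ω ∩ edgesIn U)).Reachable o a}) ↔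
    ω ∈ ({ω : Set (Sym2 V) | ∃ o ∈ O, (openGraph (ω ∩ edgesIn (U \ Z))).Reachable o v} ∩
      {ω' | ∀ o ∈ O, ∀ a ∈ A ∪ ((N \ ↑Z) ∪ rS U Z ω), ¬ (openGraph (ω' ∩ edgesIn (U \ Z))).Reachable o a}) := by
  have hZW : (↑Z : Set V) ⊆ A ∪ N := hZN.trans Set.subset_union_right
  constructor
  · rintro ⟨⟨o₀, ho₀, hov⟩, h2⟩
    -- avoidance of every observer in `G[U ∖ Z]`
    have hav : ∀ o ∈ O, ω ∈ rD (U \ Z) o (((A ∪ N) \ ↑Z) ∪ rS U Z ω) :=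
      fun o ho => (mem_rD_iff_restrict hZU (hOZ o ho) hZW ω).1 (fun a ha => h2 o ho a ha)
    refine ⟨⟨o₀, ho₀, ?_⟩, fun o ho a ha hr => ?_⟩
    · exact (reach_restrict (hOZ o₀ ho₀) (fun n hn => hav o₀ ho₀ n (Or.inr hn)) hov).2
    · rcases ha with ha | ha | ha
      · by_cases haZ : a ∈ Z
        · -- `a ∈ Z` is isolated in `G[U ∖ Z]`
          have : a = o := by
            by_contra hne
            have := SandwichBHK.mem_of_reachable hr (Ne.symm hne)
            exact (Finset.mem_sdiff.1 this).2 haZ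
          exact hOZ o ho (this ▸ haZ)
        · exact hav o ho a (Or.inl ⟨Or.inl ha, haZ⟩) hr
      · exact hav o ho a (Or.inl ⟨Or.inr ha.1, ha.2⟩) hr
      · exact hav o ho a (Or.inr ha) hr
  · rintro ⟨⟨o₀, ho₀, hov⟩, h2⟩
    refine ⟨⟨o₀, ho₀, hov.mono (openGraph_le (Set.inter_subset_inter_right _ (edgesIn_mono Finset.sdiff_subset)))⟩,
      fun o ho => ?_⟩
    have : ω ∈ rD (U \ Z) o (((A ∪ N) \ ↑Z) ∪ rS U Z ω) := by
      intro a ha hr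
      rcases ha with ⟨ha | ha, haZ⟩ | ha
      · exact h2 o ho a (Or.inl ha) hr
      · exact h2 o ho a (Or.inr (Or.inl ⟨ha, haZ⟩)) hr
      · exact h2 o ho a (Or.inr (Or.inr ha)) hr
    exact fun a ha => (mem_rD_iff_restrict hZU (hOZ o ho) hZW ω).2 this a ha

/-- **Star decomposition of `E^O_A`**: `E_U(N) = Σ_ω weight(ω) · E_{U∖Z}((N ∖ Z) ∪ S(ω))` for `Z ⊆ N`, `Z ⊆ U`, `O ∩ Z = ∅`
(conditioning on the vertices joined to `Z` by an open edge, as `CovTau.Eav_step`). [cite: VandenbergHaggstromKahn2005, §1 p. 4, identity (6)] -/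
theorem EavSet_step {U Z : Finset V} (hZU : Z ⊆ U) {A N : Set V} (hZN : (↑Z : Set V) ⊆ N) {O : Finset V} (hOZ : ∀ o ∈ O, o ∉ Z)
    (w : Sym2 V → ℝ) (hm : ∑ ω, weight w ω = 1) (v : V) :
    EavSet w U A O v N = ∑ ω, weight w ω * EavSet w (U \ Z) A O v ((N \ ↑Z) ∪ rS U Z ω) := by
  set M := meeting Z with hM
  set Φ : Set (Sym2 V) → Set (Sym2 V) → ℝ := fun ζ η =>
    ind ({ω' : Set (Sym2 V) | ∃ o ∈ O, (openGraph (ω' ∩ edgesIn (U \ Z))).Reachable o v} ∩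
      {ω' | ∀ o ∈ O, ∀ a ∈ A ∪ ((N \ ↑Z) ∪ rS U Z ζ), ¬ (openGraph (ω' ∩ edgesIn (U \ Z))).Reachable o a}) η with hΦ
  -- events of `G[U ∖ Z]` do not see the edges meeting `Z`
  have hdm : ∀ (T : Set V) (η : Set (Sym2 V)),
      (η \ meeting Z) ∈ ({ω' : Set (Sym2 V) | ∃ o ∈ O, (openGraph (ω' ∩ edgesIn (U \ Z))).Reachable o v} ∩
        {ω' | ∀ o ∈ O, ∀ a ∈ T, ¬ (openGraph (ω' ∩ edgesIn (U \ Z))).Reachable o a}) ↔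
      η ∈ ({ω' : Set (Sym2 V) | ∃ o ∈ O, (openGraph (ω' ∩ edgesIn (U \ Z))).Reachable o v} ∩
        {ω' | ∀ o ∈ O, ∀ a ∈ T, ¬ (openGraph (ω' ∩ edgesIn (U \ Z))).Reachable o a}) := by
    intro T η
    simp only [Set.mem_inter_iff, Set.mem_setOf_eq, diff_meeting_inter_edgesIn]
  have h1 : ∀ ω, ind ({ω : Set (Sym2 V) | ∃ o ∈ O, (openGraph (ω ∩ edgesIn U)).Reachable o v} ∩
      {ω | ∀ o ∈ O, ∀ a ∈ A ∪ N, ¬ (openGraph (ω ∩ edgesIn U)).Reachable o a}) ω = Φ (ω ∩ M) (ω \ M) := by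
    intro ω
    simp only [hΦ, hM, rS_inter_meeting]
    by_cases hω : ω ∈ ({ω : Set (Sym2 V) | ∃ o ∈ O, (openGraph (ω ∩ edgesIn U)).Reachable o v} ∩
        {ω | ∀ o ∈ O, ∀ a ∈ A ∪ N, ¬ (openGraph (ω ∩ edgesIn U)).Reachable o a})
    · rw [ind_of_mem hω, ind_of_mem ((hdm _ ω).2 ((mem_obsSetEv_iff_restrict hZU hZN hOZ v ω).1 hω))]
    · rw [ind_of_not_mem hω, ind_of_not_mem (fun h => hω ((mem_obsSetEv_iff_restrict hZU hZN hOZ v ω).2 ((hdm _ ω).1 h)))]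
  have h2 : ∀ ω ω', Φ (ω ∩ M) (ω' \ M) =
      ind ({η : Set (Sym2 V) | ∃ o ∈ O, (openGraph (η ∩ edgesIn (U \ Z))).Reachable o v} ∩
        {η | ∀ o ∈ O, ∀ a ∈ A ∪ ((N \ ↑Z) ∪ rS U Z ω), ¬ (openGraph (η ∩ edgesIn (U \ Z))).Reachable o a}) ω' := by
    intro ω ω'
    simp only [hΦ, hM, rS_inter_meeting]
    by_cases hω' : ω' ∈ ({η : Set (Sym2 V) | ∃ o ∈ O, (openGraph (η ∩ edgesIn (U \ Z))).Reachable o v} ∩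
        {η | ∀ o ∈ O, ∀ a ∈ A ∪ ((N \ ↑Z) ∪ rS U Z ω), ¬ (openGraph (η ∩ edgesIn (U \ Z))).Reachable o a})
    · rw [ind_of_mem hω', ind_of_mem ((hdm _ ω').2 hω')]
    · rw [ind_of_not_mem hω', ind_of_not_mem (fun h => hω' ((hdm _ ω').1 h))]
  unfold EavSet
  calc ∑ ω, weight w ω * ind ({ω : Set (Sym2 V) | ∃ o ∈ O, (openGraph (ω ∩ edgesIn U)).Reachable o v} ∩
          {ω | ∀ o ∈ O, ∀ a ∈ A ∪ N, ¬ (openGraph (ω ∩ edgesIn U)).Reachable o a}) ω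
      = (∑ ω, weight w ω) * ∑ ω, weight w ω * Φ (ω ∩ M) (ω \ M) := by
        rw [hm, one_mul]; simp_rw [h1]
    _ = ∑ ω, weight w ω * ∑ ω', weight w ω' * Φ (ω ∩ M) (ω' \ M) := blockFubini w M Φ
    _ = _ := by simp_rw [h2]

/-! ### The base case: the two-source inequality for the killed set observer inside `G[U]` -/

/-- **Transport to `G[U]`**: a weight-sum of a functional of `ω ∩ edgesIn U` is the integral under the product measure with the weights zeroed
outside `edgesIn U`. [cite: VandenbergHaggstromKahn2005, §2.1 Lemma 2.3 (p. 10)] -/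
theorem sum_weight_inter_edgesIn (p : Sym2 V → unitInterval) (U : Finset V) (F : Set (Sym2 V) → ℝ) :
    ∑ ω, weight (fun e => (p e : ℝ)) ω * F (ω ∩ edgesIn U) =
      ∫ η, F η ∂(prodBernoulli fun e => if e ∈ (edgesIn U)ᶜ then (0 : unitInterval) else p e) := by
  rw [← BHK2006.integral_comp_sdiff_prodBernoulli' p (fun e => if e ∈ (edgesIn U)ᶜ then (0 : unitInterval) else p e) (edgesIn U)ᶜ
    (fun i hi => if_pos hi) (fun i hi => if_neg hi), integral_prodBernoulli_eq_sum]
  refine Finset.sum_congr rfl fun ω _ => ?_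
  rw [Set.sdiff_compl]

/-- A weight-sum of the indicator of an event read on `ω ∩ edgesIn U` is the probability of the event under the weights zeroed outside
`edgesIn U`. [cite: VandenbergHaggstromKahn2005, §2.1 Lemma 2.3 (p. 10)] -/
theorem sum_weight_ind_inter_edgesIn (p : Sym2 V → unitInterval) (U : Finset V) (E : Set (Set (Sym2 V))) :
    ∑ ω, weight (fun e => (p e : ℝ)) ω * ind E (ω ∩ edgesIn U) =
      (prodBernoulli fun e => if e ∈ (edgesIn U)ᶜ then (0 : unitInterval) else p e).real E := by
  have hfun : (ind E : Set (Sym2 V) → ℝ) = E.indicator (1 : Set (Sym2 V) → ℝ) := by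
    funext η
    by_cases h : η ∈ E
    · rw [ind_of_mem h, Set.indicator_of_mem h, Pi.one_apply]
    · rw [ind_of_not_mem h, Set.indicator_of_notMem h]
  rw [sum_weight_inter_edgesIn p U (ind E), hfun, integral_indicator_one MeasurableSet.of_discrete]

/-- **The base case of META-A2 for the killed set observer in `G[U]`** (weights given as a `unitInterval`-valued vector): for `v ∉ A`,
`M_A(N')·E^O_A(N) ≤ E^O_A(∅)·M_A(N ∪ N')` (gen 12's `SetSurplus.setObs_twoSource_base` transported to percolation restricted to `U`).
[cite: VandenbergHaggstromKahn2005, Thm. 1.3 (p. 6), §2.1 Lemma 2.4 (p. 10)] -/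
theorem setObs_twoSource_restrict' (p : Sym2 V → unitInterval) (U : Finset V) (A : Set V) (O : Finset V) {v : V} (hvA : v ∉ A)
    (N N' : Set V) :
    Mav (fun e => (p e : ℝ)) U A v N' * EavSet (fun e => (p e : ℝ)) U A O v N ≤
      EavSet (fun e => (p e : ℝ)) U A O v ∅ * Mav (fun e => (p e : ℝ)) U A v (N ∪ N') := by
  set p' : Sym2 V → unitInterval := fun e => if e ∈ (edgesIn U)ᶜ then (0 : unitInterval) else p e with hp'
  have hvS : v ∉ A.toFinset := fun h => hvA (Set.mem_toFinset.1 h)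
  have key := SetSurplus.setObs_twoSource_base p' A.toFinset N.toFinset N'.toFinset O v hvS
  -- the four quantities as probabilities under `p'`
  have hE : ∀ T : Set V, EavSet (fun e => (p e : ℝ)) U A O v T =
      (prodBernoulli p').real ({ω : BondConfig V | ∃ o ∈ O, (openGraph ω).Reachable o v} ∩
        {ω | ∀ o ∈ O, ∀ t ∈ A.toFinset ∪ T.toFinset, ¬ (openGraph ω).Reachable o t}) := by
    intro T
    have hset : ({ω : BondConfig V | ∃ o ∈ O, (openGraph ω).Reachable o v} ∩
        {ω | ∀ o ∈ O, ∀ t ∈ A.toFinset ∪ T.toFinset, ¬ (openGraph ω).Reachable o t}) =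
        ({ω : Set (Sym2 V) | ∃ o ∈ O, (openGraph ω).Reachable o v} ∩
          {ω | ∀ o ∈ O, ∀ a ∈ A ∪ T, ¬ (openGraph ω).Reachable o a}) := by
      ext ω
      simp only [Set.mem_inter_iff, Set.mem_setOf_eq, Finset.mem_union, Set.mem_toFinset, Set.mem_union]
    rw [hset, ← sum_weight_ind_inter_edgesIn p U]
    rfl
  have hMv : ∀ T : Set V, Mav (fun e => (p e : ℝ)) U A v T =
      (prodBernoulli p').real {ω : BondConfig V | ∀ t ∈ A.toFinset ∪ T.toFinset, ¬ (openGraph ω).Reachable v t} := by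
    intro T
    have hset : {ω : BondConfig V | ∀ t ∈ A.toFinset ∪ T.toFinset, ¬ (openGraph ω).Reachable v t} =
        {ω : Set (Sym2 V) | ∀ a ∈ A ∪ T, ¬ (openGraph ω).Reachable v a} := by
      ext ω
      simp only [Set.mem_setOf_eq, Finset.mem_union, Set.mem_toFinset, Set.mem_union]
    rw [hset, ← sum_weight_ind_inter_edgesIn p U]
    rfl
  have hE0 : EavSet (fun e => (p e : ℝ)) U A O v ∅ =
      (prodBernoulli p').real ({ω : BondConfig V | ∃ o ∈ O, (openGraph ω).Reachable o v} ∩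
        {ω | ∀ o ∈ O, ∀ t ∈ A.toFinset, ¬ (openGraph ω).Reachable o t}) := by
    rw [hE ∅]; simp
  have hMNN' : Mav (fun e => (p e : ℝ)) U A v (N ∪ N') =
      (prodBernoulli p').real {ω : BondConfig V | ∀ t ∈ A.toFinset ∪ N.toFinset ∪ N'.toFinset, ¬ (openGraph ω).Reachable v t} := by
    rw [hMv (N ∪ N')]
    congr 1
    ext ω
    simp only [Set.mem_setOf_eq, Finset.mem_union, Set.mem_toFinset, Set.mem_union]
    constructor
    · intro h t ht; exact h t (by tauto)
    · intro h t ht; exact h t (by tauto)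
  rw [hMv N', hE N, hE0, hMNN', mul_comm ((prodBernoulli p').real _)]
  exact key

/-- **The base case of META-A2 for the killed set observer in `G[U]`**: for real weights in `[0,1]` and `v ∉ A`,
`M_A(N')·E^O_A(N) ≤ E^O_A(∅)·M_A(N ∪ N')`. [cite: VandenbergHaggstromKahn2005, Thm. 1.3 (p. 6), §2.1 Lemma 2.4 (p. 10)] -/
theorem setObs_twoSource_restrict (w : Sym2 V → ℝ) (hw0 : ∀ e, 0 ≤ w e) (hw1 : ∀ e, w e ≤ 1) (U : Finset V)
    (A : Set V) (O : Finset V) {v : V} (hvA : v ∉ A) (N N' : Set V) :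
    Mav w U A v N' * EavSet w U A O v N ≤ EavSet w U A O v ∅ * Mav w U A v (N ∪ N') :=
  setObs_twoSource_restrict' (fun e => ⟨w e, ⟨hw0 e, hw1 e⟩⟩) U A O hvA N N'


end Summit.CriticalPhenomena.PercolationContinuityZ3.Theorems.CovTau

end
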